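import Literature.AlgebraicGeometry.Motives.HodgeStructureDirectSum
import Literature.AlgebraicGeometry.Motives.WeilTypeCM
import HarnessLib

/-!
# The direct sum of `E`-Hodge structures of Weil type is of Weil type (the product abelian variety of Weil type)

Family `hodge`, layer `Literature/AlgebraicGeometry/Motives`; companion of `Motives/WeilTypeCM`
(actions `EndAction H E` of a number field `E` on a `ℚ`-Hodge structure, the multiplicities
`n_σ = dim_ℂ V^{1,0}_σ`, `IsOfWeilType`) and of `Motives/HodgeStructureDirectSum` (the direct sum
`HodgeStructure.pi` of a finite family, Deligne, Hodge II, 2.1). Sources read (held), verbatim: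

* E. Markman, *Secant sheaves and Weil classes on abelian varieties*, arXiv:2509.23403, §11.5
  Step 2 (arXiv v2 PDF p. 21, lines 42–47 = v1 p. 21, lines 22–27; "p. 19" of earlier versions of this
  docstring was the held corpus chunk p0019, not a PDF page): "there exists a polarized abelian surface of Weil type `(A₂,η₂,h₂)`, such that the
  discriminant of their product polarized abelian sixfold of Weil type
  `(A₁ × A₂, η, π₁^*h₁ + π₂^*h₂)` is the coset of `-1`."
* C. Schoen, Compositio Math. 114 (1998), Lemma 4 (2) (p. 331): "The multiplicity with which the
  character `φ` appears in the representation of `K*` on the global holomorphic `1` forms of the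
  Abelian variety `(V_ℝ/V_ℤ, J)` is `g - b`"; §10 (pp. 332–333): `(A, ψ_A)` "with polarization
  invariant `(2, f_A)`", "a Weil pair of rank `2`, `(V'_ℤ, ψ')` with invariant `(1, f')`", "The Weil
  pair associated to the product `A × A'` is `(H₁(A; ℤ) ⊕ V'_ℤ, ψ_A ⊕ ψ')`", "a Weil pair of rank
  `6`, `(V_ℤ, ψ)`, with invariant `(3, f)`" — multiplicities add under `⊕`.
* P. Deligne (notes by J. Milne), Hodge cycles on abelian varieties, LNM 900, §4: the function
  `σ ↦ n_σ` of an `E`-action; B. van Geemen, LNM 1594, 4.9: Weil type = `n_σ = n_σ̄ = dim/2`.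

## What is here (everything PROVED; four data definitions)

* `piMapEnd f` (the block-diagonal endomorphism `Π_j f_j` of `Π_j W_j`), `piEquiv_baseChange_piMapEnd`
  (its complexification is componentwise), `piecePiEquiv` / `finrank_piece_pi`
  (`(⊕ W_j)^{p,q} ≅ Π_j W_j^{p,q}`, `h^{p,q}` adds), `IsEffective.pi`.
* `EndAction.pi A` — **the componentwise action of `E` on `⊕_j W_j`** (the `K`-action `η` on
  `H¹(A₁ × A₂) = H¹(A₁) ⊕ H¹(A₂)`), `mem_eigenPiece_pi_iff` / `eigenPiecePiEquiv`
  (`(⊕ W_j)^{p,q}_σ ≅ Π_j (W_j)^{p,q}_σ`), `multiplicity_pi` (**`n_σ(⊕_j W_j) = Σ_j n_σ(W_j)`**, Schoen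
  Lemma 4 (2)), and `IsOfWeilType.pi`: **a finite non-empty direct sum of `E`-Hodge structures of
  Weil type is of Weil type** — for two summands, the product of abelian varieties of Weil type for
  the same `K` is of Weil type (Markman's "product polarized abelian sixfold of Weil type").

Not here: the identification of `H¹((A₁ × A₂)(ℂ), ℚ)` with `H¹(A₁(ℂ), ℚ) ⊕ H¹(A₂(ℂ), ℚ)` as
`ℚ`-Hodge structures with `K`-action (Künneth in degree `1` and the Hodge structure on the tree's
real carriers; module docstring of `HodgeTheory/WeilClasses`); the discriminant half of Schoen's
invariant `(b, f)` is `Motives/WeilDiscriminantProduct` (`weilDiscriminant_bilinOrthSum`).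

## References

* [Markman2025SurveySecant] E. Markman, Secant sheaves and Weil classes on abelian varieties,
  arXiv:2509.23403, §11.5 Step 2.
* [Schoen1998HodgeWeilAddendum] C. Schoen, Addendum to: Hodge classes on self-products of a
  variety with an automorphism, Compositio Math. 114 (1998) 329–336, Lemma 4 (2), §10.
* [Deligne1982HodgeCycles] P. Deligne, Hodge cycles on abelian varieties, LNM 900 (1982), §4.
* [DeligneHodgeII1971] P. Deligne, Théorie de Hodge II, Publ. Math. IHÉS 40 (1971), 2.1.
* [vanGeemen1994HodgeAV] B. van Geemen, LNM 1594 (1994), 4.9.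
-/

open scoped TensorProduct

noncomputable section

namespace Literature.AlgebraicGeometry.Motives

namespace HodgeStructure

universe u v w

section Pi

variable {ι : Type w} {W : ι → Type v} [∀ j, AddCommGroup (W j)] [∀ j, Module ℚ (W j)] {n : ℤ}

/-- The componentwise (block-diagonal) endomorphism `Π_j f_j` of `Π_j W_j` defined by a family of
endomorphisms `f_j ∈ End_ℚ(W_j)` — the action of `k ∈ K` on `H₁(A₁ × A₂) = H₁(A₁) ⊕ H₁(A₂)` through
`η₁(k) ⊕ η₂(k)`. [folklore] -/
def piMapEnd (f : ∀ j, Module.End ℚ (W j)) : Module.End ℚ (∀ j, W j) :=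
  LinearMap.pi fun j => f j ∘ₗ LinearMap.proj j

/-- `(Π_j f_j)(v)_j = f_j(v_j)`. [folklore] -/
@[simp]
theorem piMapEnd_apply (f : ∀ j, Module.End ℚ (W j)) (v : ∀ j, W j) (j : ι) :
    piMapEnd f v j = f j (v j) := rfl

variable [Fintype ι] [DecidableEq ι]

/-- The complexification of `Π_j f_j` is componentwise: `((Π_j f_j)_ℂ x)_j = (f_j)_ℂ (x_j)` under
`piEquiv : ℂ ⊗ (Π_j W_j) ≃ Π_j (ℂ ⊗ W_j)`. [folklore] -/
theorem piEquiv_baseChange_piMapEnd (f : ∀ j, Module.End ℚ (W j)) (x : ℂ ⊗[ℚ] (∀ j, W j))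
    (j : ι) : piEquiv W ((piMapEnd f).baseChange ℂ x) j = (f j).baseChange ℂ (piEquiv W x j) := by
  induction x using TensorProduct.induction_on with
  | zero => simp
  | tmul c v =>
    simp only [LinearMap.baseChange_tmul, piEquiv_tmul, piMapEnd_apply]
  | add x y hx hy => rw [map_add, map_add, Pi.add_apply, hx, hy, map_add, Pi.add_apply, map_add]

/-- The Hodge piece `(⊕_j W_j)^{p,q}` is linearly isomorphic to `Π_j W_j^{p,q}` (through `piEquiv`;
Deligne, Hodge II, 2.1). [cite: DeligneHodgeII1971, 2.1] -/
def piecePiEquiv (H : ∀ j, HodgeStructure (W j) n) {p q : ℤ} (hpq : p + q = n) :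
    ↥((pi H).piece p q) ≃ₗ[ℂ] ∀ j, ↥((H j).piece p q) where
  toFun x := fun j => ⟨piEquiv W x j, (mem_pi_piece_iff H hpq).1 x.2 j⟩
  map_add' x y := by
    funext j
    ext
    simp
  map_smul' c x := by
    funext j
    ext
    simp
  invFun y := ⟨(piEquiv W).symm fun j => (y j : ℂ ⊗[ℚ] W j),
    (mem_pi_piece_iff H hpq).2 fun j => by simp⟩
  left_inv x := by
    ext
    simp
  right_inv y := by
    funext j
    ext
    simp

/-- **`h^{p,q}(⊕_j W_j) = Σ_j h^{p,q}(W_j)`** for finite-dimensional `W_j` (Deligne, Hodge II, 2.1).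
[cite: DeligneHodgeII1971, 2.1] -/
theorem finrank_piece_pi [∀ j, FiniteDimensional ℚ (W j)] (H : ∀ j, HodgeStructure (W j) n)
    {p q : ℤ} (hpq : p + q = n) :
    Module.finrank ℂ ↥((pi H).piece p q) = ∑ j, Module.finrank ℂ ↥((H j).piece p q) := by
  rw [(piecePiEquiv H hpq).finrank_eq, Module.finrank_pi_fintype]

/-- **A finite direct sum of effective Hodge structures is effective**: a non-zero element of
`(⊕_j W_j)^{p,q}` has a non-zero component in some `W_j^{p,q}`. [cite: DeligneHodgeII1971, 2.1] -/
theorem IsEffective.pi {H : ∀ j, HodgeStructure (W j) n} (hH : ∀ j, (H j).IsEffective) :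
    (pi H).IsEffective := by
  intro p q hne
  by_cases hpq : p + q = n
  · obtain ⟨x, hx, hx0⟩ := (Submodule.ne_bot_iff _).1 hne
    have hxj : ∀ j, piEquiv W x j ∈ (H j).piece p q := (mem_pi_piece_iff H hpq).1 hx
    obtain ⟨j, hj⟩ : ∃ j, piEquiv W x j ≠ 0 := by
      by_contra hall
      push Not at hall
      exact hx0 ((piEquiv W).map_eq_zero_iff.1 (funext hall))
    exact hH j p q ((Submodule.ne_bot_iff _).2 ⟨_, hxj j, hj⟩)
  · exact absurd (piece_eq_bot_of_add_ne _ hpq) hne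

namespace EndAction

variable {E : Type*} [Field E] [NumberField E] {H : ∀ j, HodgeStructure (W j) n}

/-- **The direct sum of `E`-actions**: `E` acts on `⊕_j W_j` componentwise, `k ↦ Π_j ι_j(k)`; each
`Π_j ι_j(k)` preserves the Hodge filtration of the direct sum, which is componentwise. This is the
`K`-action `η` on `H¹(A₁ × A₂) = H¹(A₁) ⊕ H¹(A₂)` of "their product polarized abelian sixfold of Weil
type `(A₁ × A₂, η, π₁^*h₁ + π₂^*h₂)`" (Markman), "The Weil pair associated to the product `A × A'` is
`(H₁(A; ℤ) ⊕ V'_ℤ, ψ_A ⊕ ψ')`" (Schoen §10). [cite: Markman2025SurveySecant, §11.5 Step 2]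
[cite: Schoen1998HodgeWeilAddendum, §10 (proof of the Proposition)] [cite: DeligneHodgeII1971, 2.1] -/
def pi (A : ∀ j, EndAction (H j) E) : EndAction (HodgeStructure.pi H) E where
  ι :=
    { toFun := fun e => piMapEnd fun j => (A j).ι e
      map_one' := LinearMap.ext fun v => funext fun j => by simp
      map_mul' := fun e e' => LinearMap.ext fun v => funext fun j => by simp
      map_zero' := LinearMap.ext fun v => funext fun j => by simp
      map_add' := fun e e' => LinearMap.ext fun v => funext fun j => by simp
      commutes' := fun r => LinearMap.ext fun v => funext fun j => by
        change (A j).ι (algebraMap ℚ E r) (v j) = (algebraMap ℚ (Module.End ℚ (∀ j, W j)) r) v j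
        rw [(A j).ι.commutes, Module.algebraMap_end_apply, Module.algebraMap_end_apply,
          Pi.smul_apply] }
  map_F_le e p := by
    rintro _ ⟨x, hx, rfl⟩
    rw [SetLike.mem_coe, mem_pi_F_iff] at hx
    rw [mem_pi_F_iff]
    intro j
    rw [AlgHom.coe_mk, RingHom.coe_mk, MonoidHom.coe_mk, OneHom.coe_mk, piEquiv_baseChange_piMapEnd]
    exact (A j).map_F_le e p ⟨_, hx j, rfl⟩

/-- The action of `e ∈ E` on the direct sum is the block-diagonal `Π_j ι_j(e)` (`rfl`). [folklore] -/
@[simp]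
theorem pi_ι_apply (A : ∀ j, EndAction (H j) E) (e : E) :
    (pi A).ι e = piMapEnd fun j => (A j).ι e := rfl

/-- **The `σ`-eigen-pieces of the direct sum are the direct sums of the `σ`-eigen-pieces**:
`x ∈ (⊕_j W_j)^{p,q}_σ ↔ ∀ j, x_j ∈ (W_j)^{p,q}_σ` (the action and the Hodge pieces being
componentwise). [cite: DeligneHodgeII1971, 2.1] [cite: Deligne1982HodgeCycles, §4] -/
theorem mem_eigenPiece_pi_iff (A : ∀ j, EndAction (H j) E) (σ : E →+* ℂ) {p q : ℤ}
    (hpq : p + q = n) {x : ℂ ⊗[ℚ] (∀ j, W j)} :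
    x ∈ (pi A).eigenPiece σ p q ↔ ∀ j, piEquiv W x j ∈ (A j).eigenPiece σ p q := by
  simp only [mem_eigenPiece_iff, mem_pi_piece_iff H hpq, pi_ι_apply]
  constructor
  · rintro ⟨hx, he⟩ j
    refine ⟨hx j, fun e => ?_⟩
    have h := congrArg (fun y => piEquiv W y j) (he e)
    simpa only [piEquiv_baseChange_piMapEnd, map_smul, Pi.smul_apply] using h
  · intro h
    refine ⟨fun j => (h j).1, fun e => (piEquiv W).injective (funext fun j => ?_)⟩
    rw [piEquiv_baseChange_piMapEnd, (h j).2 e, map_smul, Pi.smul_apply]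

/-- The `σ`-eigen-piece of the direct sum is linearly isomorphic to the product of the
`σ`-eigen-pieces. [cite: DeligneHodgeII1971, 2.1] -/
def eigenPiecePiEquiv (A : ∀ j, EndAction (H j) E) (σ : E →+* ℂ) {p q : ℤ} (hpq : p + q = n) :
    ↥((pi A).eigenPiece σ p q) ≃ₗ[ℂ] ∀ j, ↥((A j).eigenPiece σ p q) where
  toFun x := fun j => ⟨piEquiv W x j, (mem_eigenPiece_pi_iff A σ hpq).1 x.2 j⟩
  map_add' x y := by
    funext j
    ext
    simp
  map_smul' c x := by
    funext j
    ext
    simp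
  invFun y := ⟨(piEquiv W).symm fun j => (y j : ℂ ⊗[ℚ] W j),
    (mem_eigenPiece_pi_iff A σ hpq).2 fun j => by simp⟩
  left_inv x := by
    ext
    simp
  right_inv y := by
    funext j
    ext
    simp

end EndAction

end Pi

/-! ### Weight one: multiplicities and Weil type -/

section WeightOne

variable {ι : Type w} [Fintype ι] [DecidableEq ι]
variable {W : ι → Type v} [∀ j, AddCommGroup (W j)] [∀ j, Module ℚ (W j)]
variable {E : Type*} [Field E] [NumberField E] {H : ∀ j, HodgeStructure (W j) 1}

namespace EndAction

/-- **Multiplicities add**: `n_σ(⊕_j W_j) = Σ_j n_σ(W_j)`, `n_σ = dim_ℂ V^{1,0}_σ`, for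
finite-dimensional `W_j` (Schoen 1998, Lemma 4 (2): the multiplicity of the character `φ` in the
holomorphic `1`-forms of `(V_ℝ/V_ℤ, J)` is `g - b`, additive for the Weil pair
`(H₁(A; ℤ) ⊕ V'_ℤ, ψ_A ⊕ ψ')` of §10: `(2, f_A)` and `(1, f')` give rank `6` and `b = 3`;
Deligne–Milne §4, the function `σ ↦ n_σ`). [cite: Schoen1998HodgeWeilAddendum, Lemma 4 (2) and §10]
[cite: Deligne1982HodgeCycles, §4] -/
theorem multiplicity_pi [∀ j, FiniteDimensional ℚ (W j)] (A : ∀ j, EndAction (H j) E)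
    (σ : E →+* ℂ) : (pi A).multiplicity σ = ∑ j, (A j).multiplicity σ := by
  simp only [multiplicity]
  rw [(eigenPiecePiEquiv A σ (by norm_num : (1 : ℤ) + 0 = 1)).finrank_eq,
    Module.finrank_pi_fintype]

/-- **A finite, non-empty direct sum of `E`-Hodge structures of Weil type is of Weil type**: the
direct sum is effective and finite-dimensional, `E` is (still) an imaginary quadratic field, and
`2 n_σ(⊕_j W_j) = Σ_j 2 n_σ(W_j) = Σ_j dim W_j^{1,0} = dim (⊕_j W_j)^{1,0}` for every `σ`. For two
summands: the product `(A₁ × A₂, η₁ × η₂)` of abelian varieties of Weil type for the same `K` is of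
Weil type — "their product polarized abelian sixfold of Weil type" (Markman §11.5 Step 2), the
Weil pair of `A × A'` in Schoen's §10 (with invariant `(3, f)` from `(2, f_A)` and `(1, f')`).
[cite: Markman2025SurveySecant, §11.5 Step 2] [cite: Schoen1998HodgeWeilAddendum, Lemma 4 (2) and §10]
[cite: vanGeemen1994HodgeAV, 4.9] -/
theorem IsOfWeilType.pi [Nonempty ι] {A : ∀ j, EndAction (H j) E}
    (hA : ∀ j, (A j).IsOfWeilType) : (EndAction.pi A).IsOfWeilType := by
  haveI : ∀ j, FiniteDimensional ℚ (W j) := fun j => (hA j).2.1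
  obtain ⟨j₀⟩ := ‹Nonempty ι›
  refine ⟨IsEffective.pi fun j => (hA j).1, inferInstance, (hA j₀).2.2.1, (hA j₀).2.2.2.1,
    fun σ => ?_⟩
  rw [multiplicity_pi, finrank_piece_pi H (by norm_num : (1 : ℤ) + 0 = 1), Finset.mul_sum]
  exact Finset.sum_congr rfl fun j _ => (hA j).2.2.2.2 σ

end EndAction

end WeightOne

end HodgeStructure

end Literature.AlgebraicGeometry.Motives

end
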